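/-
Copyright (c) 2026. All rights reserved.
Released under Apache 2.0 license as described in the file LICENSE.
Authors: abc-iut cell — seat abc-iut-w4-d104 (gen 3), over abc-iut-w5-d079's `OneParameterSubgroupsPSL2R*` chain
(row «Cor2.7(d)-second-half-at-disc-model», file 3a: the (T1)-general step of abc-iut-L4-t7's spec).
-/
import Literature.AnabelianGeometry.AbsoluteAnabelian.OneParameterSubgroupsPSL2RProofs
import Literature.AnabelianGeometry.AbsoluteAnabelian.AutHolomorphicSpacesPSL2RLemmas
import HarnessLib

/-!
# One-parameter subgroups of `SL₂(ℝ)/{±1}`, continued: every continuous one-parameter subgroup is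
# `t ↦ π(exp tX)`; closed-form coefficients; orbit velocities and fixed points on `ℍ`

Towards [AbsTopIII] Cor 2.7 (d) (S. Mochizuki, *Topics in absolute anabelian geometry III*, kurims p.59, bib key
`MochizukiAbsTopIII2015`), whose second half speaks of "orbits `S · p` of one-parameter subgroups
`S ⊆ 𝒜_𝕍(V^top) [≅ SL₂(ℝ)/{±1}]`" and of line segments "tangent to `S · p` at `p`".  PROOF-ONLY file (no
definitions), continuing abc-iut-w5-d079's classification (`closure_range_cases`, `exists_homeomorph_line`,
`exists_eq_line_smul`, `exists_homeomorph_addCircle`) and the closed forms of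
`Literature/Analysis/Matrix/RealExponentialScalarSquare` (`exp_smul_two_of_det_*`):

* `exists_eq_coe_mul_of_continuous_additive` — a continuous additive `ℝ → ℝ/pℤ` is `t ↦ (a t) mod p`
  (covering-lift argument adapted from w5-d079's `not_injective_of_continuous_additive`);
* **`exists_exp_form`** — EVERY continuous homomorphism `f : ℝ → SL₂(ℝ)/{±1}` is `t ↦ π(exp (tX))` for a
  traceless `X` (possibly `0`): one-parameter subgroups in the sense of the repaired reading of
  `OneParameterSubgroupsPSL2R` are matrix one-parameter groups (Hall 2015 Def. 2.13 / Thm. 2.14 for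
  `SL₂(ℝ)`, pushed to the quotient);
* `exists_exp_smul_eq_coeffs` — `exp (tX) = a(t) • 1 + b(t) • X` with `a(0) = 1`, `a'(0) = 0`, `b(0) = 0`,
  `b'(0) = 1`;
* **`hasDerivAt_coe_expHom_smul`** — the orbit `t ↦ exp(tX) · τ` of a point `τ` of the upper half plane
  is differentiable at `t = 0` with velocity the infinitesimal generator `X₀₁ + (X₀₀ − X₁₁) τ − X₁₀ τ²`;
* **`forall_expHom_smul_eq_iff`** — `τ` is fixed by the whole one-parameter subgroup IFF that generator
  vanishes at `τ` (so an orbit through a non-fixed point has NON-ZERO velocity).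

The sequel `ArchimedeanReconstructionOrbitVelocityProofs.lean` transports these to `Aut^hol` of an
Aut-holomorphic disc (Prop 2.2 (ii), `exists_continuousMulEquiv_sl`) and to the planar pictures used in
`ArchimedeanReconstructionOrthogonalFramesProofs.lean`.  Classical Lie theory serving a cited reconstruction
step of the refereed [AbsTopIII] §2; nothing here bears on the disputed [IUTchIII] Cor. 3.12; typed ≠ endorsed.
-/

noncomputable section

open NormedSpace Filter Topology Set

namespace Literature.AnabelianGeometry.AbsoluteAnabelian

namespace OneParameterSubgroupsPSL2R

open Matrix Literature.Analysis.Matrix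

open scoped MatrixGroups

open scoped Matrix.Norms.Operator UpperHalfPlane

set_option backward.isDefEq.respectTransparency false

/-! ### Continuous additive maps from the line to a circle are linear -/

/-- **A continuous additive map `g : ℝ → ℝ/pℤ` is `t ↦ (a t) mod p`**: `g` lifts through the covering
`ℝ → ℝ/pℤ` to a continuous ADDITIVE map (the defect `F(s+t) - F(s) - F(t)` is continuous, `pℤ`-valued and
vanishes at `0`), hence `F(t) = a t` (adapted from abc-iut-w5-d079's `not_injective_of_continuous_additive`).
[cite: MochizukiAbsTopIII2015, Corollary 2.7 (d) p.59] -/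
theorem exists_eq_coe_mul_of_continuous_additive {p : ℝ} (hp : 0 < p) (g : ℝ → AddCircle p)
    (hg : Continuous g) (hadd : ∀ s t, g (s + t) = g s + g t) :
    ∃ a : ℝ, ∀ t, g t = ((t * a : ℝ) : AddCircle p) := by
  have hg0 : g 0 = 0 := by
    have := hadd 0 0
    rw [add_zero] at this
    exact left_eq_add.mp this
  -- lift through the covering `ℝ → ℝ/pℤ`
  have cov : IsCoveringMap ((↑) : ℝ → AddCircle p) := AddCircle.isCoveringMap_coe p
  obtain ⟨F, ⟨hF0, hFlift⟩, -⟩ :=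
    cov.existsUnique_continuousMap_lifts ⟨g, hg⟩ 0 0 (by simpa using hg0.symm)
  have hF : ∀ t, ((F t : ℝ) : AddCircle p) = g t := fun t => congrFun hFlift t
  -- the defect `D (s, t) = F (s + t) - F s - F t` is `pℤ`-valued, continuous, `D (0,0) = 0`
  let D : ℝ × ℝ → ℝ := fun q => F (q.1 + q.2) - F q.1 - F q.2
  have hDc : Continuous D := by
    have hFc := F.continuous
    exact ((hFc.comp (continuous_fst.add continuous_snd)).sub (hFc.comp continuous_fst)).sub
      (hFc.comp continuous_snd)
  have hDval : ∀ q, ∃ k : ℤ, k • p = D q := by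
    intro q
    have h0 : ((D q : ℝ) : AddCircle p) = 0 := by
      simp only [D, QuotientAddGroup.mk_sub, hF, hadd, add_sub_cancel_left, sub_self]
    exact AddSubgroup.mem_zmultiples_iff.mp ((QuotientAddGroup.eq_zero_iff _).mp h0)
  have hD00 : D (0, 0) = 0 := by simp [D, hF0]
  have hD : ∀ q, D q = 0 := by
    intro q
    obtain ⟨k, hk⟩ := hDval q
    have hR : IsPreconnected (Set.range D) := isPreconnected_range hDc
    have hhalf : ∀ x ∈ Set.range D, x ≠ p / 2 ∧ x ≠ -(p / 2) := by
      rintro _ ⟨q', rfl⟩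
      obtain ⟨k', hk'⟩ := hDval q'
      constructor
      · intro h
        rw [← hk', zsmul_eq_mul] at h
        have h1 : (2 * (k' : ℝ) - 1) * p = 0 := by linarith
        have h2 : (2 * (k' : ℝ) - 1) = 0 := (mul_eq_zero.mp h1).resolve_right hp.ne'
        have h3 : (2 * k' - 1 : ℤ) = 0 := by exact_mod_cast h2
        omega
      · intro h
        rw [← hk', zsmul_eq_mul] at h
        have h1 : (2 * (k' : ℝ) + 1) * p = 0 := by linarith
        have h2 : (2 * (k' : ℝ) + 1) = 0 := (mul_eq_zero.mp h1).resolve_right hp.ne'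
        have h3 : (2 * k' + 1 : ℤ) = 0 := by exact_mod_cast h2
        omega
    rcases lt_trichotomy k 0 with hk0 | hk0 | hk0
    · exfalso
      have hle : D q ≤ -p := by
        rw [← hk, zsmul_eq_mul]
        have : (k : ℝ) ≤ -1 := by exact_mod_cast (show k ≤ -1 by omega)
        nlinarith
      have hmem : -(p / 2) ∈ Set.range D :=
        hR.Icc_subset ⟨q, rfl⟩ ⟨(0, 0), hD00⟩ ⟨by linarith, by linarith⟩
      exact (hhalf _ hmem).2 rfl
    · rw [← hk, hk0, zero_smul]
    · exfalso
      have hle : p ≤ D q := by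
        rw [← hk, zsmul_eq_mul]
        have : (1 : ℝ) ≤ k := by exact_mod_cast (show 1 ≤ k by omega)
        nlinarith
      have hmem : p / 2 ∈ Set.range D :=
        hR.Icc_subset ⟨(0, 0), hD00⟩ ⟨q, rfl⟩ ⟨by linarith, by linarith⟩
      exact (hhalf _ hmem).1 rfl
  -- so `F` is additive and continuous, hence linear
  let Fₐ : ℝ →+ ℝ :=
    { toFun := F
      map_zero' := hF0
      map_add' := fun s t => by have := hD (s, t); simp only [D] at this; linarith }
  have hlin : ∀ t : ℝ, F t = t * F 1 := by
    intro t
    have := map_real_smul Fₐ F.continuous t 1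
    simpa [Fₐ] using this
  exact ⟨F 1, fun t => by rw [← hF, hlin]⟩

/-! ### Every continuous one-parameter subgroup of `SL₂(ℝ)/{±1}` is `t ↦ π(exp tX)` -/

/-- **Exponential form of the continuous one-parameter subgroups of `SL₂(ℝ)/{±1}`**: for every continuous
homomorphism `f : ℝ → SL₂(ℝ)/{±1}` there is a traceless `X ∈ M₂(ℝ)` (possibly `0`) with
`f(t) = π(exp (tX))` for all `t` — assembled from abc-iut-w5-d079's trichotomy (`closure_range_cases`, the line
and circle structure of the closure, `exists_eq_line_smul`) and the circle analogue above.
[cite: MochizukiAbsTopIII2015, Corollary 2.7 (d) p.59] -/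
theorem exists_exp_form (f : Multiplicative ℝ →* (SL(2, ℝ) ⧸ Subgroup.center SL(2, ℝ))) (hf : Continuous f) :
    ∃ X : Matrix (Fin 2) (Fin 2) ℝ, X.trace = 0 ∧ ∃ φ : Multiplicative ℝ →* SL(2, ℝ), Continuous φ ∧
      (∀ t : ℝ, ((φ (Multiplicative.ofAdd t) : SL(2, ℝ)) : Matrix (Fin 2) (Fin 2) ℝ) = exp (t • X)) ∧
      ∀ t : ℝ, f (Multiplicative.ofAdd t) =
        ((φ (Multiplicative.ofAdd t) : SL(2, ℝ)) : SL(2, ℝ) ⧸ Subgroup.center SL(2, ℝ)) := by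
  haveI : IsClosed ((Subgroup.center SL(2, ℝ) : Subgroup SL(2, ℝ)) : Set SL(2, ℝ)) := isClosed_center
  have hfT : ∀ t, f t ∈ f.range.topologicalClosure :=
    fun t => Subgroup.le_topologicalClosure _ ⟨t, rfl⟩
  -- rescaling a one-parameter group `φ₀` by `a`: `t ↦ φ₀ (a t)` has generator `a • X₀`
  have rescale : ∀ (X₀ : Matrix (Fin 2) (Fin 2) ℝ), X₀.trace = 0 →
      ∀ φ₀ : Multiplicative ℝ →* SL(2, ℝ), Continuous φ₀ →
      (∀ t : ℝ, ((φ₀ (Multiplicative.ofAdd t) : SL(2, ℝ)) : Matrix (Fin 2) (Fin 2) ℝ) = exp (t • X₀)) →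
      ∀ a : ℝ, (∀ t : ℝ, f (Multiplicative.ofAdd t) =
        ((φ₀ (Multiplicative.ofAdd (t * a)) : SL(2, ℝ)) : SL(2, ℝ) ⧸ Subgroup.center SL(2, ℝ))) →
      ∃ X : Matrix (Fin 2) (Fin 2) ℝ, X.trace = 0 ∧ ∃ φ : Multiplicative ℝ →* SL(2, ℝ), Continuous φ ∧
        (∀ t : ℝ, ((φ (Multiplicative.ofAdd t) : SL(2, ℝ)) : Matrix (Fin 2) (Fin 2) ℝ) = exp (t • X)) ∧
        ∀ t : ℝ, f (Multiplicative.ofAdd t) =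
          ((φ (Multiplicative.ofAdd t) : SL(2, ℝ)) : SL(2, ℝ) ⧸ Subgroup.center SL(2, ℝ)) := by
    intro X₀ hX₀ φ₀ hφ₀c hφ₀ a ha
    let s : Multiplicative ℝ →* Multiplicative ℝ :=
      { toFun := fun t => Multiplicative.ofAdd (t.toAdd * a)
        map_one' := by simp
        map_mul' := fun x y => by rw [← ofAdd_add, toAdd_mul, add_mul] }
    have hs : Continuous s := continuous_ofAdd.comp (continuous_toAdd.mul continuous_const)
    refine ⟨a • X₀, by rw [Matrix.trace_smul, hX₀, smul_zero], φ₀.comp s, hφ₀c.comp hs, fun t => ?_,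
      fun t => ?_⟩
    · change ((φ₀ (Multiplicative.ofAdd ((Multiplicative.ofAdd t).toAdd * a)) : SL(2, ℝ)) :
          Matrix (Fin 2) (Fin 2) ℝ) = exp (t • a • X₀)
      rw [toAdd_ofAdd, hφ₀, smul_smul]
    · change f (Multiplicative.ofAdd t) =
        ((φ₀ (Multiplicative.ofAdd ((Multiplicative.ofAdd t).toAdd * a)) : SL(2, ℝ)) :
          SL(2, ℝ) ⧸ Subgroup.center SL(2, ℝ))
      rw [toAdd_ofAdd, ha]
  rcases closure_range_cases f hf with hbot | ⟨X₀, hX₀, hX₀0, φ₀, hφ₀c, hφ₀, hrange⟩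
  · -- trivial `f`: `X = 0`
    refine ⟨0, Matrix.trace_zero _ _, 1, continuous_const, fun t => ?_, fun t => ?_⟩
    · simp [NormedSpace.exp_zero]
    · have h := hfT (Multiplicative.ofAdd t)
      rw [hbot, Subgroup.mem_bot] at h
      rw [h]; simp
  rcases le_or_gt X₀.det 0 with hdet | hdet
  · -- line
    obtain ⟨e, he, hemul⟩ := exists_homeomorph_line _ (Subgroup.isClosed_topologicalClosure _)
      X₀ hX₀ hX₀0 hdet φ₀ hφ₀c hφ₀ hrange
    obtain ⟨a, ha⟩ := exists_eq_line_smul _ e hemul f hf hfT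
    exact rescale X₀ hX₀ φ₀ hφ₀c hφ₀ a fun t => by rw [ha, he]
  · -- circle
    obtain ⟨e, he, headd⟩ := exists_homeomorph_addCircle _ X₀ hX₀ hX₀0 hdet φ₀ hφ₀c hφ₀ hrange
    have hp : 0 < Real.pi / Real.sqrt X₀.det := div_pos Real.pi_pos (Real.sqrt_pos.mpr hdet)
    have hesymm : ∀ x y, e.symm (x * y) = e.symm x + e.symm y := by
      intro x y
      apply e.injective
      rw [headd, e.apply_symm_apply, e.apply_symm_apply, e.apply_symm_apply]
    let g : ℝ → AddCircle (Real.pi / Real.sqrt X₀.det) :=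
      fun t => e.symm ⟨f (Multiplicative.ofAdd t), hfT _⟩
    have hgc : Continuous g := by
      have h1 : Continuous fun t : ℝ =>
          (⟨f (Multiplicative.ofAdd t), hfT _⟩ : f.range.topologicalClosure) :=
        (hf.comp continuous_ofAdd).subtype_mk _
      exact e.symm.continuous.comp h1
    have hgadd : ∀ s t, g (s + t) = g s + g t := by
      intro s t
      simp only [g]
      rw [← hesymm]
      congr 1
      apply Subtype.ext
      change f (Multiplicative.ofAdd (s + t)) = f (Multiplicative.ofAdd s) * f (Multiplicative.ofAdd t)
      rw [ofAdd_add, map_mul]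
    obtain ⟨a, ha⟩ := exists_eq_coe_mul_of_continuous_additive hp g hgc hgadd
    refine rescale X₀ hX₀ φ₀ hφ₀c hφ₀ a fun t => ?_
    have h1 : e (g t) = ⟨f (Multiplicative.ofAdd t), hfT _⟩ := by
      simp only [g, Homeomorph.apply_symm_apply]
    have h2 := congrArg (fun x : f.range.topologicalClosure => (x : SL(2, ℝ) ⧸ Subgroup.center SL(2, ℝ))) h1
    simp only at h2
    rw [← h2, ha t, he]

/-! ### Closed forms: `exp (tX) = a(t) • 1 + b(t) • X` with `a(0) = 1, a'(0) = 0, b(0) = 0, b'(0) = 1` -/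

/-- **Closed-form coefficients of `exp (tX)`** for a traceless `X ∈ M₂(ℝ)` (the three cases `det X > 0`,
`< 0`, `= 0` of the tree's `exp_smul_two_of_det_*`: `(cos ωt, sin ωt/ω)`, `(cosh ωt, sinh ωt/ω)`, `(1, t)`),
with the values and derivatives at `t = 0` that the orbit computation needs.
[cite: Hall2015, §2.6 Exercise 6 (2.12) p.47; MochizukiAbsTopIII2015, Corollary 2.7 (d) p.59] -/
theorem exists_exp_smul_eq_coeffs (X : Matrix (Fin 2) (Fin 2) ℝ) (hX : X.trace = 0) :
    ∃ a b : ℝ → ℝ, (∀ t, exp (t • X) = a t • (1 : Matrix (Fin 2) (Fin 2) ℝ) + b t • X) ∧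
      a 0 = 1 ∧ b 0 = 0 ∧ HasDerivAt a 0 0 ∧ HasDerivAt b 1 0 := by
  rcases lt_trichotomy X.det 0 with hdet | hdet | hdet
  · set ω := Real.sqrt (-X.det) with hω
    have hω0 : ω ≠ 0 := (Real.sqrt_pos.mpr (neg_pos.mpr hdet)).ne'
    refine ⟨fun t => Real.cosh (ω * t), fun t => Real.sinh (ω * t) / ω,
      fun t => exp_smul_two_of_det_neg X hX hdet t, by simp, by simp, ?_, ?_⟩
    · have h := (Real.hasDerivAt_cosh (ω * 0)).comp 0 ((hasDerivAt_id (0 : ℝ)).const_mul ω)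
      simp only [mul_zero, Real.sinh_zero, zero_mul, mul_one] at h
      exact h
    · have h := ((Real.hasDerivAt_sinh (ω * 0)).comp 0 ((hasDerivAt_id (0 : ℝ)).const_mul ω)).div_const ω
      simp only [mul_zero, Real.cosh_zero, mul_one, one_mul] at h
      rwa [div_self hω0] at h
  · refine ⟨fun _ => 1, fun t => t, fun t => by rw [exp_smul_two_of_det_eq_zero X hX hdet t, one_smul],
      rfl, rfl, hasDerivAt_const 0 1, hasDerivAt_id 0⟩
  · set ω := Real.sqrt X.det with hω
    have hω0 : ω ≠ 0 := (Real.sqrt_pos.mpr hdet).ne'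
    refine ⟨fun t => Real.cos (ω * t), fun t => Real.sin (ω * t) / ω,
      fun t => exp_smul_two_of_det_pos X hX hdet t, by simp, by simp, ?_, ?_⟩
    · have h := (Real.hasDerivAt_cos (ω * 0)).comp 0 ((hasDerivAt_id (0 : ℝ)).const_mul ω)
      simp only [mul_zero, Real.sin_zero, neg_zero, zero_mul, mul_one] at h
      exact h
    · have h := ((Real.hasDerivAt_sin (ω * 0)).comp 0 ((hasDerivAt_id (0 : ℝ)).const_mul ω)).div_const ω
      simp only [mul_zero, Real.cos_zero, mul_one, one_mul] at h
      rwa [div_self hω0] at h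

/-! ### Orbits of one-parameter subgroups on `ℍ`: velocity and fixed points -/

/-- Entries of a one-parameter group in closed form. [cite: MochizukiAbsTopIII2015, Corollary 2.7 (d) p.59] -/
theorem expHom_apply_entries {X : Matrix (Fin 2) (Fin 2) ℝ} {a b : ℝ → ℝ}
    (hab : ∀ t, exp (t • X) = a t • (1 : Matrix (Fin 2) (Fin 2) ℝ) + b t • X)
    (φ : Multiplicative ℝ →* SL(2, ℝ))
    (hφ : ∀ t : ℝ, ((φ (Multiplicative.ofAdd t) : SL(2, ℝ)) : Matrix (Fin 2) (Fin 2) ℝ) = exp (t • X)) (t : ℝ) :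
    (φ (Multiplicative.ofAdd t) : SL(2, ℝ)) 0 0 = a t + b t * X 0 0 ∧
    (φ (Multiplicative.ofAdd t) : SL(2, ℝ)) 0 1 = b t * X 0 1 ∧
    (φ (Multiplicative.ofAdd t) : SL(2, ℝ)) 1 0 = b t * X 1 0 ∧
    (φ (Multiplicative.ofAdd t) : SL(2, ℝ)) 1 1 = a t + b t * X 1 1 := by
  have h : ∀ i j, (φ (Multiplicative.ofAdd t) : SL(2, ℝ)) i j = (a t • (1 : Matrix (Fin 2) (Fin 2) ℝ) + b t • X) i j :=
    fun i j => by rw [← hab, ← hφ]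
  refine ⟨?_, ?_, ?_, ?_⟩ <;> simp [h]

/-- **Velocity of the orbit `t ↦ exp(tX) · τ` on `ℍ` at `t = 0`**: the infinitesimal generator
`X₀₁ + (X₀₀ − X₁₁) τ − X₁₀ τ²` of the Möbius flow (quotient rule on the closed form).
[cite: MochizukiAbsTopIII2015, Corollary 2.7 (d) p.59] -/
theorem hasDerivAt_coe_expHom_smul (X : Matrix (Fin 2) (Fin 2) ℝ) (hX : X.trace = 0)
    (φ : Multiplicative ℝ →* SL(2, ℝ))
    (hφ : ∀ t : ℝ, ((φ (Multiplicative.ofAdd t) : SL(2, ℝ)) : Matrix (Fin 2) (Fin 2) ℝ) = exp (t • X)) (τ : ℍ) :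
    HasDerivAt (fun t : ℝ => ((φ (Multiplicative.ofAdd t) • τ : ℍ) : ℂ))
      (((X 0 1 : ℝ) : ℂ) + (((X 0 0 : ℝ) : ℂ) - ((X 1 1 : ℝ) : ℂ)) * τ - ((X 1 0 : ℝ) : ℂ) * (τ : ℂ) ^ 2) 0 := by
  obtain ⟨a, b, hab, ha0, hb0, ha, hb⟩ := exists_exp_smul_eq_coeffs X hX
  -- the orbit in coordinates: `N t / D t`
  have hfun : (fun t : ℝ => ((φ (Multiplicative.ofAdd t) • τ : ℍ) : ℂ)) = fun t : ℝ =>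
      (((a t + b t * X 0 0 : ℝ) : ℂ) * τ + ((b t * X 0 1 : ℝ) : ℂ)) /
        (((b t * X 1 0 : ℝ) : ℂ) * τ + ((a t + b t * X 1 1 : ℝ) : ℂ)) := by
    funext t
    obtain ⟨h00, h01, h10, h11⟩ := expHom_apply_entries hab φ hφ t
    rw [coe_sl_smul, h00, h01, h10, h11]
  rw [hfun]
  -- derivatives of numerator and denominator at `0`
  have hac : HasDerivAt (fun t : ℝ => ((a t : ℝ) : ℂ)) 0 0 := by simpa using ha.ofReal_comp
  have hbc : HasDerivAt (fun t : ℝ => ((b t : ℝ) : ℂ)) 1 0 := by simpa using hb.ofReal_comp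
  have hN : HasDerivAt (fun t : ℝ => ((a t + b t * X 0 0 : ℝ) : ℂ) * τ + ((b t * X 0 1 : ℝ) : ℂ))
      ((0 + 1 * ((X 0 0 : ℝ) : ℂ)) * τ + 1 * ((X 0 1 : ℝ) : ℂ)) 0 := by
    have h1 : HasDerivAt (fun t : ℝ => ((a t + b t * X 0 0 : ℝ) : ℂ)) (0 + 1 * ((X 0 0 : ℝ) : ℂ)) 0 := by
      have e1 : (fun t : ℝ => ((a t + b t * X 0 0 : ℝ) : ℂ)) =
          fun t : ℝ => ((a t : ℝ) : ℂ) + ((b t : ℝ) : ℂ) * ((X 0 0 : ℝ) : ℂ) := by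
        funext t; push_cast; ring
      rw [e1]
      exact hac.add (hbc.mul_const ((X 0 0 : ℝ) : ℂ))
    have h2 : HasDerivAt (fun t : ℝ => ((b t * X 0 1 : ℝ) : ℂ)) (1 * ((X 0 1 : ℝ) : ℂ)) 0 := by
      simpa [Complex.ofReal_mul] using hbc.mul_const ((X 0 1 : ℝ) : ℂ)
    exact (h1.mul_const (τ : ℂ)).add h2
  have hD : HasDerivAt (fun t : ℝ => ((b t * X 1 0 : ℝ) : ℂ) * τ + ((a t + b t * X 1 1 : ℝ) : ℂ))
      (1 * ((X 1 0 : ℝ) : ℂ) * τ + (0 + 1 * ((X 1 1 : ℝ) : ℂ))) 0 := by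
    have h1 : HasDerivAt (fun t : ℝ => ((b t * X 1 0 : ℝ) : ℂ)) (1 * ((X 1 0 : ℝ) : ℂ)) 0 := by
      simpa [Complex.ofReal_mul] using hbc.mul_const ((X 1 0 : ℝ) : ℂ)
    have h2 : HasDerivAt (fun t : ℝ => ((a t + b t * X 1 1 : ℝ) : ℂ)) (0 + 1 * ((X 1 1 : ℝ) : ℂ)) 0 := by
      have e1 : (fun t : ℝ => ((a t + b t * X 1 1 : ℝ) : ℂ)) =
          fun t : ℝ => ((a t : ℝ) : ℂ) + ((b t : ℝ) : ℂ) * ((X 1 1 : ℝ) : ℂ) := by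
        funext t; push_cast; ring
      rw [e1]
      exact hac.add (hbc.mul_const ((X 1 1 : ℝ) : ℂ))
    exact (h1.mul_const (τ : ℂ)).add h2
  have hD0 : ((b 0 * X 1 0 : ℝ) : ℂ) * τ + ((a 0 + b 0 * X 1 1 : ℝ) : ℂ) = 1 := by
    rw [ha0, hb0]; push_cast; ring
  have hD0' : ((b 0 * X 1 0 : ℝ) : ℂ) * τ + ((a 0 + b 0 * X 1 1 : ℝ) : ℂ) ≠ 0 := by
    rw [hD0]; exact one_ne_zero
  have h := hN.div hD hD0'
  have hN0 : ((a 0 + b 0 * X 0 0 : ℝ) : ℂ) * τ + ((b 0 * X 0 1 : ℝ) : ℂ) = τ := by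
    rw [ha0, hb0]; push_cast; ring
  rw [hD0, hN0] at h
  refine h.congr_deriv ?_
  ring

/-- **Fixed points of a one-parameter subgroup on `ℍ` are the zeros of its generator**: `exp(tX) · τ = τ`
for all `t` IFF `X₀₁ + (X₀₀ − X₁₁) τ − X₁₀ τ² = 0` (⇐: on the closed form the numerator is `τ ·` denominator;
⇒: the constant orbit has velocity `0`). [cite: MochizukiAbsTopIII2015, Corollary 2.7 (d) p.59] -/
theorem forall_expHom_smul_eq_iff (X : Matrix (Fin 2) (Fin 2) ℝ) (hX : X.trace = 0)
    (φ : Multiplicative ℝ →* SL(2, ℝ))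
    (hφ : ∀ t : ℝ, ((φ (Multiplicative.ofAdd t) : SL(2, ℝ)) : Matrix (Fin 2) (Fin 2) ℝ) = exp (t • X)) (τ : ℍ) :
    (∀ t : ℝ, φ (Multiplicative.ofAdd t) • τ = τ) ↔
      ((X 0 1 : ℝ) : ℂ) + (((X 0 0 : ℝ) : ℂ) - ((X 1 1 : ℝ) : ℂ)) * τ - ((X 1 0 : ℝ) : ℂ) * (τ : ℂ) ^ 2 = 0 := by
  constructor
  · intro hfix
    have hconst : (fun t : ℝ => ((φ (Multiplicative.ofAdd t) • τ : ℍ) : ℂ)) = fun _ => (τ : ℂ) := by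
      funext t; rw [hfix t]
    have h := hasDerivAt_coe_expHom_smul X hX φ hφ τ
    rw [hconst] at h
    exact h.unique (hasDerivAt_const (0 : ℝ) (τ : ℂ))
  · intro hv t
    obtain ⟨a, b, hab, -, -, -, -⟩ := exists_exp_smul_eq_coeffs X hX
    obtain ⟨h00, h01, h10, h11⟩ := expHom_apply_entries hab φ hφ t
    apply UpperHalfPlane.ext
    rw [coe_sl_smul, h00, h01, h10, h11]
    have hden : ((b t * X 1 0 : ℝ) : ℂ) * τ + ((a t + b t * X 1 1 : ℝ) : ℂ) ≠ 0 := by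
      have h := sl_denom_ne_zero (φ (Multiplicative.ofAdd t)) τ.im_pos
      rwa [h10, h11] at h
    rw [div_eq_iff hden]
    push_cast
    linear_combination (b t : ℂ) * hv

end OneParameterSubgroupsPSL2R

end Literature.AnabelianGeometry.AbsoluteAnabelian

end
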